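import Mathlib
import HarnessLib
import Literature.Analysis.Approximation.RationalDeLaValleePoussin

/-!
# Best approximation by alternation: Rivlin Thm. 2.10, Cor. 2.6.2, Thm. 2.1 (A), Ex. 2.4.2–2.4.4

Source: T. J. Rivlin, *The Chebyshev Polynomials*, Wiley 1974 (held scan
`book:rivlinnd-chebyshev-polynomials`, bib key `Rivlin1974`): Sect. 2.2 Definition 2.5 (best
approximation out of `V`, `E_V(f)`, `E_n(f)`) and Corollary 2.6.2 (scan chunks 40–41); Sect. 2.4
"Approximation on an Interval", Theorem 2.9 and Theorem 2.10 (scan chunks 44–45); Sect. 2.1 Theorem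
2.1 and its "reinterpretation (A)" (scan chunk 36); Sect. 1.2 (1.13)–(1.14), (1.19) (scan chunk 8);
Exercises 2.4.2, 2.4.3, 2.4.4 (scan chunk 48).

The text. Definition 2.5: `v* ∈ V` is a *best approximation* to `f` on `B` out of `V` if `‖f - v*‖ ≤
‖f - v‖` for all `v ∈ V`, and `‖f - v*‖ = E_V(f)` (`E_n(f)` when `V = 𝒫ₙ`). Corollary 2.6.2: if `y₁,
…, y_r` is the base of an extremal signature `σ` then `E_V(f) ≥ minᵢ σ(yᵢ)[f(yᵢ) - v(yᵢ)]` for every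
`v ∈ V`; on a real interval the extremal signatures for a Haar space of dimension `k` are exactly
the alternating signs on `k + 1` ordered points (Theorem 2.9), which turns Corollary 2.6.2 into de
la Vallée Poussin's lower bound and gives Theorem 2.10: for `S` a closed subset of `[a, b]`, `v₀` is
the best approximation to `f` on `S` iff `f - v₀` attains `±‖f - v₀‖_S` with alternating signs at `k
+ 1` ordered points of `S`. Theorem 2.1 (A): the polynomial in `𝒫_{n-1}` closest to `xⁿ` on `I =
[-1, 1]` is `xⁿ - T̃ₙ` (error `T̃ₙ = 2^{1-n} Tₙ`, which equioscillates on the `n + 1` extrema `η_j`,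
`Tₙ(η_j) = (-1)^j`). Exercise 2.4.2: the best approximation to `x^{n+2}` on `I` out of `𝒫ₙ` is
`x^{n+2} - 2^{-(n+1)} T_{n+2}` (it lies in `𝒫ₙ` by the parity (1.13) of `T_{n+2}`), so `E_n(x^{n+2})
= 2^{-(n+1)}`. Exercise 2.4.3: if `v*` is best to `f` then `v* + v` is best to `f + v`, `E_V(f) =
E_V(f + v)` (`v ∈ V`). Exercise 2.4.4: for convex `f` the best approximation out of `𝒫₁` on `[a, b]`
is `[f(a)(b-c) + f(b)(c-a) + f(c)(b-a)]/(2(b-a)) + [(f(b) - f(a))/(b - a)](x - c)` with `E₁(f) =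
[f(a)(b-c) + f(b)(c-a) - f(c)(b-a)]/(2(b-a))`, where `f'(c) = (f(b) - f(a))/(b - a)`.

What is here (sorry-free, `V = 𝒫ₙ` over `ℝ`, `S ⊆ ℝ` arbitrary):
* the predicate `IsMinimaxPoly S f n p E` — "`p ∈ 𝒫ₙ` is a best approximation to `f` on `S` out of
`𝒫ₙ` and `E = ‖f - p‖_S = E_n(f; S)`" — with its bookkeeping: `E` is the least deviation
(`IsMinimaxPoly.isLeast`, `eq_of_isMinimaxPoly`), `E` is attained (`isGreatest`), invariance under
adding a member of `𝒫ₙ` (Exercise 2.4.3, `add_polynomial`/`sub_polynomial`), scaling and negation;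
* Corollary 2.6.2 for `𝒫ₙ` = de la Vallée Poussin's bound (`exists_le_abs_sub_eval_of_alternation`,
`le_of_alternation`), a weight-one wrapper of the tree's weighted statement
`Literature.Analysis.Approximation.RationalChebyshev.exists_le_abs_of_alternant_poly` (cited, not
restated);
* Theorem 2.10, sufficiency half, on an arbitrary `S ⊆ ℝ` (`isMinimaxPoly_of_equioscillation`, and
the weak-inequality form `isMinimaxPoly_of_alternation`);
* the Chebyshev equioscillation principle behind Theorem 2.1 (A) and Exercise 2.4.2: if `f - p =
c·T_m` on `I` with `deg p ≤ n < m` then `p` is best out of `𝒫ₙ` with `E = |c|`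
(`isMinimaxPoly_of_sub_eq_mul_T`, using Mathlib's extremal nodes `Polynomial.Chebyshev.node` and
`eval_T_real_node`); Theorem 2.1 (A) (`isMinimaxPoly_pow_succ`: `x^{n+1} - 2^{-n} T_{n+1}` is best
to `x^{n+1}` out of `𝒫ₙ`, `E_n = 2^{-n}`); Exercise 2.4.2 (`isMinimaxPoly_pow_add_two`,
`isLeast_deviation_pow_add_two`) via the parity fact (1.13) in coefficient form (`coeff_T_pred`:
`T_{n+1}` has no `xⁿ` term) and (1.14) (`coeff_T_self`);
* Exercise 2.4.4 (`isMinimaxPoly_one_of_convexOn`), with the hypothesis `f'' > 0` weakened to "`f`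
convex on `[a, b]` and `f'(c)` equals the chord slope at some `a < c < b`" (the chord lies above
`f`, the tangent at `c` below, and `a < c < b` is a 3-point alternant).

NOT typed: the necessity half of Theorem 2.10 and existence of best approximations (Theorem 2.4/Cor.
2.6.1 need `S` compact and `f` continuous), uniqueness (Theorems 2.8, 2.11), Theorem 2.9 itself
(alternating signs *are* the extremal signatures), Exercise 2.4.1, and the uniqueness of `c` in
Exercise 2.4.4.

Honest framing: shared numerical engines serving client cells; rigour lives in the verifiers; every
published number belongs to a client cell's ledger, not to the engines group.
-/
open Polynomial Set

namespace Literature.Analysis.Approximation.AlternationBestApproximation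

/-- `IsMinimaxPoly S f n p E`: `p` is a best approximation to `f` on `S` out of `𝒫ₙ` **and** `E = ‖f
- p‖_S = E_n(f; S)` — `deg p ≤ n`, `|f - p| ≤ E` on `S`, and every `q ∈ 𝒫ₙ` deviates from `f` by at
least `E` somewhere on `S` (Definition 2.5 with `V = 𝒫ₙ`; no compactness of `S` or continuity of `f`
is built in, the predicate only records the inequalities). [cite: Rivlin1974, Sect. 2.2 Def. 2.5] -/
def IsMinimaxPoly (S : Set ℝ) (f : ℝ → ℝ) (n : ℕ) (p : ℝ[X]) (E : ℝ) : Prop :=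
  p.natDegree ≤ n ∧ (∀ x ∈ S, |f x - p.eval x| ≤ E) ∧
    ∀ q : ℝ[X], q.natDegree ≤ n → ∃ x ∈ S, E ≤ |f x - q.eval x|

namespace IsMinimaxPoly

variable {S : Set ℝ} {f : ℝ → ℝ} {n : ℕ} {p : ℝ[X]} {E : ℝ}

/-- `p ∈ 𝒫ₙ`. [cite: Rivlin1974, Sect. 2.2 Def. 2.5] -/
theorem poly_natDegree_le (h : IsMinimaxPoly S f n p E) : p.natDegree ≤ n := h.1

/-- `|f(x) - p(x)| ≤ E` on `S`. [cite: Rivlin1974, Sect. 2.2 Def. 2.5] -/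
theorem abs_sub_eval_le_deviation (h : IsMinimaxPoly S f n p E) {x : ℝ} (hx : x ∈ S) :
    |f x - p.eval x| ≤ E := h.2.1 x hx

/-- No `q ∈ 𝒫ₙ` does better than `E` on `S`. [cite: Rivlin1974, Sect. 2.2 Def. 2.5] -/
theorem exists_deviation_le_abs_sub_eval (h : IsMinimaxPoly S f n p E) {q : ℝ[X]}
    (hq : q.natDegree ≤ n) :
    ∃ x ∈ S, E ≤ |f x - q.eval x| := h.2.2 q hq

/-- `S ≠ ∅` (the third clause needs a point). [cite: Rivlin1974, Sect. 2.2 Def. 2.5] -/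
theorem set_nonempty (h : IsMinimaxPoly S f n p E) : S.Nonempty := by
  obtain ⟨x, hx, -⟩ := h.exists_deviation_le_abs_sub_eval h.poly_natDegree_le
  exact ⟨x, hx⟩

/-- `E ≥ 0`. [cite: Rivlin1974, Sect. 2.2 Def. 2.5] -/
theorem error_nonneg (h : IsMinimaxPoly S f n p E) : 0 ≤ E := by
  obtain ⟨x, hx⟩ := h.set_nonempty
  exact (abs_nonneg _).trans (h.abs_sub_eval_le_deviation hx)

/-- `E ≤ ‖f - q‖_S` for every `q ∈ 𝒫ₙ`: `E = E_n(f; S)` is the least deviation. [cite: Rivlin1974,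
Sect. 2.2 Def. 2.5] -/
theorem deviation_le_of_forall_abs_sub_eval_le (h : IsMinimaxPoly S f n p E) {q : ℝ[X]}
    (hq : q.natDegree ≤ n) {E' : ℝ} (hE' : ∀ x ∈ S, |f x - q.eval x| ≤ E') : E ≤ E' := by
  obtain ⟨x, hx, hle⟩ := h.exists_deviation_le_abs_sub_eval hq
  exact hle.trans (hE' x hx)

/-- `E = E_n(f; S) = min {‖f - q‖_S : q ∈ 𝒫ₙ}` as an `IsLeast` statement. [cite: Rivlin1974, Sect.
2.2 Def. 2.5] -/
theorem isLeast_deviation (h : IsMinimaxPoly S f n p E) :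
    IsLeast {E' : ℝ | ∃ q : ℝ[X], q.natDegree ≤ n ∧ ∀ x ∈ S, |f x - q.eval x| ≤ E'} E :=
  ⟨⟨p, h.poly_natDegree_le, h.2.1⟩,
    fun _ ⟨_, hq, hE'⟩ => h.deviation_le_of_forall_abs_sub_eval_le hq hE'⟩

/-- `E_n(f; S)` is well defined: two best approximations have the same deviation. [cite: Rivlin1974,
Sect. 2.2 Def. 2.5] -/
theorem deviation_eq_of_isMinimaxPoly (h : IsMinimaxPoly S f n p E) {p' : ℝ[X]} {E' : ℝ}
    (h' : IsMinimaxPoly S f n p' E') : E = E' :=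
  le_antisymm (h.deviation_le_of_forall_abs_sub_eval_le h'.poly_natDegree_le h'.2.1)
    (h'.deviation_le_of_forall_abs_sub_eval_le h.poly_natDegree_le h.2.1)

/-- `E = ‖f - p‖_S` is attained: `E = max_{x ∈ S} |f(x) - p(x)|`. [cite: Rivlin1974, Sect. 2.2 Def.
2.5] -/
theorem isGreatest_deviation (h : IsMinimaxPoly S f n p E) :
    IsGreatest ((fun x => |f x - p.eval x|) '' S) E := by
  obtain ⟨x, hx, hle⟩ := h.exists_deviation_le_abs_sub_eval h.poly_natDegree_le
  refine ⟨⟨x, hx, le_antisymm (h.abs_sub_eval_le_deviation hx) hle⟩, ?_⟩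
  rintro _ ⟨y, hy, rfl⟩
  exact h.abs_sub_eval_le_deviation hy

/-- Exercise 2.4.3: if `p` is best to `f` out of `𝒫ₙ` then `p + v` is best to `f + v` (`v ∈ 𝒫ₙ`),
with the same deviation. [cite: Rivlin1974, Ex. 2.4.3] -/
theorem add_polynomial (h : IsMinimaxPoly S f n p E) {v : ℝ[X]} (hv : v.natDegree ≤ n) :
    IsMinimaxPoly S (fun x => f x + v.eval x) n (p + v) E := by
  refine ⟨(natDegree_add_le _ _).trans (max_le h.poly_natDegree_le hv), fun x hx => ?_,
    fun q hq => ?_⟩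
  · rw [eval_add, show f x + v.eval x - (p.eval x + v.eval x) = f x - p.eval x by ring]
    exact h.abs_sub_eval_le_deviation hx
  · obtain ⟨x, hx, hle⟩ := h.exists_deviation_le_abs_sub_eval
      (q := q - v) ((natDegree_sub_le _ _).trans (max_le hq hv))
    refine ⟨x, hx, ?_⟩
    rwa [eval_sub, show f x - (q.eval x - v.eval x) = f x + v.eval x - q.eval x by ring] at hle

/-- Exercise 2.4.3, second half: `E_n(f) = E_n(f - v)` for `v ∈ 𝒫ₙ` (`p - v` is best to `f - v`).
[cite: Rivlin1974, Ex. 2.4.3] -/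
theorem sub_polynomial (h : IsMinimaxPoly S f n p E) {v : ℝ[X]} (hv : v.natDegree ≤ n) :
    IsMinimaxPoly S (fun x => f x - v.eval x) n (p - v) E := by
  have h2 := h.add_polynomial (v := -v) (by rwa [natDegree_neg])
  simp only [eval_neg, ← sub_eq_add_neg] at h2
  exact h2

/-- Scaling: `a·p` is best to `a·f` with deviation `|a| E` (immediate from Definition 2.5; used e.g.
in Exercise 2.4.19). [cite: Rivlin1974, Sect. 2.2 Def. 2.5] -/
theorem scale_const_mul (h : IsMinimaxPoly S f n p E) (a : ℝ) :
    IsMinimaxPoly S (fun x => a * f x) n (C a * p) (|a| * E) := by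
  refine ⟨(natDegree_C_mul_le _ _).trans h.poly_natDegree_le, fun x hx => ?_, fun q hq => ?_⟩
  · rw [eval_mul, eval_C, ← mul_sub, abs_mul]
    exact mul_le_mul_of_nonneg_left (h.abs_sub_eval_le_deviation hx) (abs_nonneg a)
  · rcases eq_or_ne a 0 with rfl | ha
    · obtain ⟨x, hx⟩ := h.set_nonempty
      exact ⟨x, hx, by simp⟩
    · obtain ⟨x, hx, hle⟩ := h.exists_deviation_le_abs_sub_eval (q := C a⁻¹ * q)
        ((natDegree_C_mul_le _ _).trans hq)
      refine ⟨x, hx, ?_⟩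
      rw [eval_mul, eval_C] at hle
      have : a * f x - q.eval x = a * (f x - a⁻¹ * q.eval x) := by field_simp
      rw [this, abs_mul]
      exact mul_le_mul_of_nonneg_left hle (abs_nonneg a)

/-- `-p` is best to `-f`. [cite: Rivlin1974, Sect. 2.2 Def. 2.5] -/
theorem neg_fun (h : IsMinimaxPoly S f n p E) : IsMinimaxPoly S (fun x => -f x) n (-p) E := by
  have h2 := h.scale_const_mul (-1)
  simp only [neg_mul, one_mul, abs_neg, abs_one, map_neg, map_one] at h2
  exact h2

/-- Only the values of `f` on `S` matter. [cite: Rivlin1974, Sect. 2.2 Def. 2.5] -/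
theorem congr_eqOn (h : IsMinimaxPoly S f n p E) {g : ℝ → ℝ} (hfg : EqOn f g S) :
    IsMinimaxPoly S g n p E := by
  refine ⟨h.poly_natDegree_le, fun x hx => ?_, fun q hq => ?_⟩
  · rw [← hfg hx]; exact h.abs_sub_eval_le_deviation hx
  · obtain ⟨x, hx, hle⟩ := h.exists_deviation_le_abs_sub_eval hq
    exact ⟨x, hx, by rwa [← hfg hx]⟩

end IsMinimaxPoly

/-- Corollary 2.6.2 for `V = 𝒫ₙ` on the line, i.e. de la Vallée Poussin's theorem (the extremal
signatures being the alternating signs on `n + 2` ordered points, Theorem 2.9): if `s(-1)^j (f -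
p₀)(t_j) ≥ c` at nodes `t₀ < ⋯ < t_{n+1}` for some `p₀ ∈ 𝒫ₙ`, then every `q ∈ 𝒫ₙ` has `|f(t_j) -
q(t_j)| ≥ c` at some node. Weight-one case of the tree's
`RationalChebyshev.exists_le_abs_of_alternant_poly` (cited, not restated). [cite: Rivlin1974, Sect.
2.2 Cor. 2.6.2; Sect. 2.4 Thm. 2.9] -/
theorem exists_le_abs_sub_eval_of_alternation {n : ℕ} {t : ℕ → ℝ}
    (ht : ∀ ⦃i j : ℕ⦄, i < j → j ≤ n + 1 → t i < t j) (f : ℝ → ℝ) {p₀ : ℝ[X]}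
    (hp₀ : p₀.natDegree ≤ n) {s c : ℝ} (hs : s = 1 ∨ s = -1)
    (halt : ∀ j ≤ n + 1, c ≤ s * (-1) ^ j * (f (t j) - p₀.eval (t j)))
    {q : ℝ[X]} (hq : q.natDegree ≤ n) :
    ∃ j ≤ n + 1, c ≤ |f (t j) - q.eval (t j)| := by
  obtain ⟨j, hj, h⟩ := RationalChebyshev.exists_le_abs_of_alternant_poly ht f (fun _ => 1)
    (fun _ _ => one_pos) hq hp₀ hs (c := c) (fun j hj => by simpa using halt j hj)
  exact ⟨j, hj, by simpa using h⟩

/-- Corollary 2.6.2 as a bound on deviations: under the same alternation, `c ≤ ‖f - q‖_S` for every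
`q ∈ 𝒫ₙ` once the nodes lie in `S`; i.e. `c ≤ E_n(f; S)`. [cite: Rivlin1974, Sect. 2.2 Cor. 2.6.2;
Sect. 2.4 Thm. 2.9] -/
theorem le_of_alternation {S : Set ℝ} {n : ℕ} {t : ℕ → ℝ}
    (ht : ∀ ⦃i j : ℕ⦄, i < j → j ≤ n + 1 → t i < t j) (htS : ∀ j ≤ n + 1, t j ∈ S)
    (f : ℝ → ℝ) {p₀ : ℝ[X]} (hp₀ : p₀.natDegree ≤ n) {s c : ℝ} (hs : s = 1 ∨ s = -1)
    (halt : ∀ j ≤ n + 1, c ≤ s * (-1) ^ j * (f (t j) - p₀.eval (t j)))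
    {q : ℝ[X]} (hq : q.natDegree ≤ n) {E' : ℝ} (hE' : ∀ x ∈ S, |f x - q.eval x| ≤ E') :
    c ≤ E' := by
  obtain ⟨j, hj, h⟩ := exists_le_abs_sub_eval_of_alternation ht f hp₀ hs halt hq
  exact h.trans (hE' _ (htS j hj))

/-- Theorem 2.10, sufficiency half, for `V = 𝒫ₙ` and any `S ⊆ ℝ`: if `p ∈ 𝒫ₙ`, `|f - p| ≤ E` on `S`,
and `f(t_j) - p(t_j) = s(-1)^j E` (`s = ±1`) at `n + 2` points `t₀ < ⋯ < t_{n+1}` of `S`, then `p`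
is a best approximation to `f` on `S` out of `𝒫ₙ` and `E = E_n(f; S)`. (Necessity — which needs `S`
closed and `f` continuous — and uniqueness are not typed.) [cite: Rivlin1974, Sect. 2.4 Thm. 2.10]
-/
theorem isMinimaxPoly_of_equioscillation {S : Set ℝ} {f : ℝ → ℝ} {n : ℕ} {p : ℝ[X]} {E : ℝ}
    (hp : p.natDegree ≤ n) (hbound : ∀ x ∈ S, |f x - p.eval x| ≤ E)
    {t : ℕ → ℝ} (ht : ∀ ⦃i j : ℕ⦄, i < j → j ≤ n + 1 → t i < t j) (htS : ∀ j ≤ n + 1, t j ∈ S)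
    {s : ℝ} (hs : s = 1 ∨ s = -1)
    (hequi : ∀ j ≤ n + 1, f (t j) - p.eval (t j) = s * (-1) ^ j * E) :
    IsMinimaxPoly S f n p E := by
  refine ⟨hp, hbound, fun q hq => ?_⟩
  have hss : s * s = 1 := by rcases hs with rfl | rfl <;> norm_num
  have halt : ∀ j ≤ n + 1, E ≤ s * (-1) ^ j * (f (t j) - p.eval (t j)) := by
    intro j hj
    rw [hequi j hj]
    have : s * (-1) ^ j * (s * (-1) ^ j * E) = (s * s) * ((-1) ^ j * (-1) ^ j) * E := by ring
    rw [this, hss, ← pow_add, ← two_mul, pow_mul, neg_one_sq, one_pow, one_mul, one_mul]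
  obtain ⟨j, hj, h⟩ := exists_le_abs_sub_eval_of_alternation ht f hp hs halt hq
  exact ⟨t j, htS j hj, h⟩

/-- Theorem 2.10, sufficiency, weak-inequality form: `|f - p| ≤ E` on `S` and `s(-1)^j (f - p)(t_j)
≥ E` at `n + 2` ordered points of `S` already force `p` best with `E = E_n(f; S)`. [cite:
Rivlin1974, Sect. 2.4 Thm. 2.10] -/
theorem isMinimaxPoly_of_alternation {S : Set ℝ} {f : ℝ → ℝ} {n : ℕ} {p : ℝ[X]} {E : ℝ}
    (hp : p.natDegree ≤ n) (hbound : ∀ x ∈ S, |f x - p.eval x| ≤ E)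
    {t : ℕ → ℝ} (ht : ∀ ⦃i j : ℕ⦄, i < j → j ≤ n + 1 → t i < t j) (htS : ∀ j ≤ n + 1, t j ∈ S)
    {s : ℝ} (hs : s = 1 ∨ s = -1)
    (halt : ∀ j ≤ n + 1, E ≤ s * (-1) ^ j * (f (t j) - p.eval (t j))) :
    IsMinimaxPoly S f n p E := by
  refine ⟨hp, hbound, fun q hq => ?_⟩
  obtain ⟨j, hj, h⟩ := exists_le_abs_sub_eval_of_alternation ht f hp hs halt hq
  exact ⟨t j, htS j hj, h⟩

section Chebyshev

open Polynomial.Chebyshev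

/-- The extrema `η_k = cos(kπ/m)` of `T_m` (Mathlib `Polynomial.Chebyshev.node`) listed
increasingly: `η_{m-i} < η_{m-j}` for `i < j ≤ m`. [cite: Rivlin1974, Sect. 1.2 (1.19); Sect. 2.1
Thm. 2.1, proof] -/
theorem node_rev_lt {m i j : ℕ} (hij : i < j) (hj : j ≤ m) : node m (m - i) < node m (m - j) :=
  node_lt (Nat.sub_le m i) (by omega)

/-- `T_m(η_{m-j}) = (-1)^{m-j} = (-1)^m (-1)^j`: `T_m` equioscillates on the increasing nodes.
[cite: Rivlin1974, Sect. 1.2 (1.19); Sect. 2.1 Thm. 2.1, proof] -/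
theorem eval_T_node_rev {m j : ℕ} (hj : j ≤ m) :
    (T ℝ m).eval (node m (m - j)) = (-1) ^ m * (-1) ^ j := by
  rw [eval_T_real_node (Finset.mem_Iic.mpr (Nat.sub_le m j))]
  have h1 : ((-1 : ℝ) ^ j) * (-1) ^ j = 1 := by rw [← mul_pow, neg_one_mul, neg_neg, one_pow]
  calc ((-1 : ℝ)) ^ (m - j) = (-1) ^ (m - j) * ((-1) ^ j * (-1) ^ j) := by rw [h1, mul_one]
    _ = (-1) ^ (m - j + j) * (-1) ^ j := by rw [pow_add, mul_assoc]
    _ = (-1) ^ m * (-1) ^ j := by rw [Nat.sub_add_cancel hj]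

/-- The Chebyshev equioscillation principle (the mechanism of Theorem 2.1 (A) and Exercise 2.4.2,
via Theorem 2.10): if `f - p = c·T_m` on `I = [-1, 1]` with `p ∈ 𝒫ₙ` and `n < m`, then `p` is a best
approximation to `f` on `I` out of `𝒫ₙ` and `E_n(f) = |c|` (the error equioscillates on the `m + 1 ≥
n + 2` extrema of `T_m`). [cite: Rivlin1974, Sect. 2.1 Thm. 2.1 (A); Sect. 2.4 Thm. 2.10] -/
theorem isMinimaxPoly_of_sub_eq_mul_T {f : ℝ → ℝ} {n m : ℕ} (hnm : n + 1 ≤ m) {p : ℝ[X]}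
    (hp : p.natDegree ≤ n) {c : ℝ}
    (hfp : ∀ x ∈ Icc (-1 : ℝ) 1, f x - p.eval x = c * (T ℝ m).eval x) :
    IsMinimaxPoly (Icc (-1 : ℝ) 1) f n p |c| := by
  have hbound : ∀ x ∈ Icc (-1 : ℝ) 1, |f x - p.eval x| ≤ |c| := by
    intro x hx
    rw [hfp x hx, abs_mul]
    exact mul_le_of_le_one_right (abs_nonneg c)
      (abs_eval_T_real_le_one (m : ℤ) (abs_le.mpr ⟨hx.1, hx.2⟩))
  have ht : ∀ ⦃i j : ℕ⦄, i < j → j ≤ n + 1 → node m (m - i) < node m (m - j) :=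
    fun i j hij hj => node_rev_lt hij (hj.trans hnm)
  have htS : ∀ j ≤ n + 1, node m (m - j) ∈ Icc (-1 : ℝ) 1 := fun j _ => node_mem_Icc
  have hval : ∀ j ≤ n + 1, f (node m (m - j)) - p.eval (node m (m - j)) =
      c * ((-1) ^ m * (-1) ^ j) := fun j hj => by
    rw [hfp _ node_mem_Icc, eval_T_node_rev (hj.trans hnm)]
  have hsm : ((-1 : ℝ)) ^ m = 1 ∨ ((-1 : ℝ)) ^ m = -1 := neg_one_pow_eq_or ℝ m
  rcases le_or_gt 0 c with hc | hc
  · refine isMinimaxPoly_of_equioscillation hp hbound ht htS (s := (-1) ^ m) hsm fun j hj => ?_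
    rw [hval j hj, abs_of_nonneg hc]; ring
  · refine isMinimaxPoly_of_equioscillation hp hbound ht htS (s := -(-1) ^ m)
      (by rcases hsm with h | h <;> simp [h]) fun j hj => ?_
    rw [hval j hj, abs_of_neg hc]; ring

/-- (1.14) in coefficient form: the coefficient of `x^{n+1}` in `T_{n+1}` is `t_{n+1} = 2ⁿ` (Mathlib
`leadingCoeff_T`). [cite: Rivlin1974, Sect. 1.2 (1.14)] -/
theorem coeff_T_self (n : ℕ) : (T ℝ (n + 1)).coeff (n + 1) = 2 ^ n := by
  have hdeg : (T ℝ ((n : ℤ) + 1)).natDegree = n + 1 := by rw [natDegree_T]; omega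
  have hlc : (T ℝ ((n : ℤ) + 1)).leadingCoeff = 2 ^ n := by
    rw [leadingCoeff_T, show ((n : ℤ) + 1).natAbs - 1 = n by omega]
  rwa [Polynomial.leadingCoeff, hdeg] at hlc

/-- `T_k ∈ 𝒫_{|k|}`: no coefficients beyond `x^{|k|}` (Mathlib `natDegree_T`). [cite: Rivlin1974,
Sect. 1.2 (1.10), (1.14)] -/
theorem coeff_T_eq_zero_of_lt {k : ℤ} {N : ℕ} (h : k.natAbs < N) : (T ℝ k).coeff N = 0 :=
  coeff_eq_zero_of_natDegree_lt (by rwa [natDegree_T])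

/-- (1.13) in coefficient form: `T_{n+1}` contains only powers of `x` of the parity of `n + 1`, in
particular it has no `xⁿ` term (two-step induction on the recurrence). [cite: Rivlin1974, Sect. 1.2
(1.13)] -/
theorem coeff_T_pred (n : ℕ) : (T ℝ (n + 1)).coeff n = 0 := by
  induction n using Nat.twoStepInduction with
  | zero => simp
  | one =>
    rw [show ((1 : ℕ) : ℤ) + 1 = 2 by norm_num, T_two]
    rw [show (2 : ℝ[X]) * X ^ 2 - 1 = Polynomial.C 2 * X ^ 2 - Polynomial.C 1 by
      rw [map_one, ← map_ofNat Polynomial.C 2]]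
    rw [coeff_sub, coeff_C_mul, coeff_X_pow, coeff_C]
    norm_num
  | more n h1 h2 =>
    rw [show ((n + 2 : ℕ) : ℤ) + 1 = ((n + 1 : ℕ) : ℤ) + 2 by push_cast; ring, T_add_two,
      show (2 : ℝ[X]) * X * T ℝ (((n + 1 : ℕ) : ℤ) + 1) =
          Polynomial.C 2 * (X * T ℝ (((n + 1 : ℕ) : ℤ) + 1)) by
        rw [← map_ofNat Polynomial.C 2, mul_assoc],
      coeff_sub, coeff_C_mul, coeff_X_mul, h2, coeff_T_eq_zero_of_lt (by omega)]
    norm_num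

/-- `x^{n+1} - 2^{-n} T_{n+1} ∈ 𝒫ₙ` (the leading terms cancel by (1.14)). [cite: Rivlin1974, Sect.
2.1 Thm. 2.1 (A); Sect. 1.2 (1.14)] -/
theorem natDegree_X_pow_succ_sub_C_mul_T_le (n : ℕ) :
    (X ^ (n + 1) - Polynomial.C (1 / 2 ^ n) * T ℝ (n + 1) : ℝ[X]).natDegree ≤ n := by
  rw [natDegree_le_iff_coeff_eq_zero]
  intro N hN
  rw [coeff_sub, coeff_C_mul, coeff_X_pow]
  rcases Nat.lt_or_ge (n + 1) N with h | h
  · rw [if_neg (by omega), coeff_T_eq_zero_of_lt (by omega)]; ring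
  · obtain rfl : N = n + 1 := by omega
    rw [if_pos rfl, coeff_T_self, one_div, inv_mul_cancel₀ (by positivity), sub_self]

/-- Theorem 2.1, reinterpretation (A): the polynomial in `𝒫ₙ` closest to `x^{n+1}` on `I` is
`x^{n+1} - T̃_{n+1} = x^{n+1} - 2^{-n} T_{n+1}`, and `E_n(x^{n+1}) = 2^{-n}`. [cite: Rivlin1974,
Sect. 2.1 Thm. 2.1 (A)] -/
theorem isMinimaxPoly_pow_succ (n : ℕ) :
    IsMinimaxPoly (Icc (-1 : ℝ) 1) (fun x => x ^ (n + 1)) n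
      (X ^ (n + 1) - Polynomial.C (1 / 2 ^ n) * T ℝ (n + 1)) (1 / 2 ^ n) := by
  have h := isMinimaxPoly_of_sub_eq_mul_T (f := fun x => x ^ (n + 1)) (m := n + 1) le_rfl
    (natDegree_X_pow_succ_sub_C_mul_T_le n) (c := 1 / 2 ^ n) (fun x _ => by simp)
  rwa [abs_of_pos (by positivity)] at h

/-- `x^{n+2} - 2^{-(n+1)} T_{n+2} ∈ 𝒫ₙ`: besides the leading terms, the `x^{n+1}` coefficient
vanishes by the parity (1.13). [cite: Rivlin1974, Ex. 2.4.2; Sect. 1.2 (1.13)] -/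
theorem natDegree_X_pow_add_two_sub_C_mul_T_le (n : ℕ) :
    (X ^ (n + 2) - Polynomial.C (1 / 2 ^ (n + 1)) * T ℝ (n + 2) : ℝ[X]).natDegree ≤ n := by
  rw [natDegree_le_iff_coeff_eq_zero]
  intro N hN
  rw [coeff_sub, coeff_C_mul, coeff_X_pow]
  rcases Nat.lt_or_ge (n + 2) N with h | h
  · rw [if_neg (by omega), coeff_T_eq_zero_of_lt (by omega)]; ring
  · rcases (show N = n + 1 ∨ N = n + 1 + 1 by omega) with rfl | rfl
    · rw [if_neg (by omega), show ((n : ℤ) + 2) = ((n + 1 : ℕ) : ℤ) + 1 by push_cast; ring,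
        coeff_T_pred (n + 1)]; ring
    · rw [if_pos rfl, show ((n : ℤ) + 2) = ((n + 1 : ℕ) : ℤ) + 1 by push_cast; ring,
        coeff_T_self (n + 1), one_div, inv_mul_cancel₀ (by positivity), sub_self]

/-- Exercise 2.4.2: the best approximation to `x^{n+2}` on `I = [-1, 1]` out of `𝒫ₙ` is `x^{n+2} -
2^{-(n+1)} T_{n+2}` (the same as out of `𝒫_{n+1}`), with `E_n(x^{n+2}) = 2^{-(n+1)}`. [cite:
Rivlin1974, Ex. 2.4.2] -/
theorem isMinimaxPoly_pow_add_two (n : ℕ) :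
    IsMinimaxPoly (Icc (-1 : ℝ) 1) (fun x => x ^ (n + 2)) n
      (X ^ (n + 2) - Polynomial.C (1 / 2 ^ (n + 1)) * T ℝ (n + 2)) (1 / 2 ^ (n + 1)) := by
  have h := isMinimaxPoly_of_sub_eq_mul_T (f := fun x => x ^ (n + 2)) (m := n + 2) (by omega)
    (natDegree_X_pow_add_two_sub_C_mul_T_le n) (c := 1 / 2 ^ (n + 1)) (fun x _ => by simp)
  rwa [abs_of_pos (by positivity)] at h

/-- Exercise 2.4.2, the value: `E_n(x^{n+2}; I) = min_{q ∈ 𝒫ₙ} ‖x^{n+2} - q‖_I = 2^{-(n+1)}`. [cite: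
Rivlin1974, Ex. 2.4.2] -/
theorem isLeast_deviation_pow_add_two (n : ℕ) :
    IsLeast {E' : ℝ | ∃ q : ℝ[X], q.natDegree ≤ n ∧
      ∀ x ∈ Icc (-1 : ℝ) 1, |x ^ (n + 2) - q.eval x| ≤ E'} (1 / 2 ^ (n + 1)) :=
  (isMinimaxPoly_pow_add_two n).isLeast_deviation

end Chebyshev

section Convex

/-- Exercise 2.4.4 (with `f'' > 0` weakened to convexity): if `f` is convex on `[a, b]` and `f'(c) =
(f(b) - f(a))/(b - a)` at some `a < c < b`, then `[f(a)(b-c) + f(b)(c-a) + f(c)(b-a)]/(2(b-a)) +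
[(f(b) - f(a))/(b - a)](x - c)` is a best approximation to `f` on `[a, b]` out of `𝒫₁` and `E₁(f) =
[f(a)(b-c) + f(b)(c-a) - f(c)(b-a)]/(2(b-a))` (the chord bounds `f` above, the tangent at `c` below,
and `a < c < b` is a 3-point alternant). [cite: Rivlin1974, Ex. 2.4.4] -/
theorem isMinimaxPoly_one_of_convexOn {a b c : ℝ} (hac : a < c) (hcb : c < b) {f : ℝ → ℝ}
    (hf : ConvexOn ℝ (Icc a b) f) (hderiv : HasDerivAt f ((f b - f a) / (b - a)) c) :
    IsMinimaxPoly (Icc a b) f 1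
      (C ((f a * (b - c) + f b * (c - a) + f c * (b - a)) / (2 * (b - a))) +
        C ((f b - f a) / (b - a)) * (X - C c))
      ((f a * (b - c) + f b * (c - a) - f c * (b - a)) / (2 * (b - a))) := by
  have hab : a < b := hac.trans hcb
  have hba : 0 < b - a := sub_pos.mpr hab
  have hba' : b - a ≠ 0 := hba.ne'
  set m := (f b - f a) / (b - a) with hm
  set E := (f a * (b - c) + f b * (c - a) - f c * (b - a)) / (2 * (b - a)) with hE
  set q₀ := (f a * (b - c) + f b * (c - a) + f c * (b - a)) / (2 * (b - a)) with hq₀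
  have hev : ∀ x, (C q₀ + C m * (X - C c)).eval x = q₀ + m * (x - c) := by intro x; simp
  -- the three node identities
  have hEa : f a - (q₀ + m * (a - c)) = E := by rw [hq₀, hE, hm]; field_simp; ring
  have hEb : f b - (q₀ + m * (b - c)) = E := by rw [hq₀, hE, hm]; field_simp; ring
  have hEc : f c - (q₀ + m * (c - c)) = -E := by rw [hq₀, hE]; field_simp; ring
  -- chord bound (convexity): f x ≤ f a + m (x - a)
  have hchord : ∀ x ∈ Icc a b, f x ≤ f a + m * (x - a) := by
    intro x hx
    have hθ : f (((b - x) / (b - a)) • a + ((x - a) / (b - a)) • b) ≤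
        ((b - x) / (b - a)) • f a + ((x - a) / (b - a)) • f b :=
      hf.2 (left_mem_Icc.mpr hab.le) (right_mem_Icc.mpr hab.le)
        (div_nonneg (by linarith [hx.2]) hba.le) (div_nonneg (by linarith [hx.1]) hba.le)
        (by field_simp; ring)
    have hx' : ((b - x) / (b - a)) • a + ((x - a) / (b - a)) • b = x := by
      simp only [smul_eq_mul]; field_simp; ring
    rw [hx'] at hθ
    simp only [smul_eq_mul] at hθ
    have hid : (b - x) / (b - a) * f a + (x - a) / (b - a) * f b = f a + m * (x - a) := by
      rw [hm]; field_simp; ring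
    linarith
  -- tangent bound (convexity + derivative at c): f c + m (x - c) ≤ f x
  have htangent : ∀ x ∈ Icc a b, f c + m * (x - c) ≤ f x := by
    intro x hx
    have hc : c ∈ Icc a b := ⟨hac.le, hcb.le⟩
    rcases lt_trichotomy x c with hxc | rfl | hcx
    · have h := hf.slope_le_of_hasDerivAt hx hc hxc hderiv
      rw [slope_def_field, div_le_iff₀ (sub_pos.mpr hxc)] at h
      linarith
    · simp
    · have h := hf.le_slope_of_hasDerivAt hc hx hcx hderiv
      rw [slope_def_field, le_div_iff₀ (sub_pos.mpr hcx)] at h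
      linarith
  have hbound : ∀ x ∈ Icc a b, |f x - (C q₀ + C m * (X - C c)).eval x| ≤ E := by
    intro x hx
    rw [hev, abs_le]
    constructor
    · linarith [htangent x hx]
    · linarith [hchord x hx]
  -- nodes a < c < b
  have hp : (C q₀ + C m * (X - C c)).natDegree ≤ 1 :=
    (natDegree_add_le _ _).trans (max_le (by simp)
      ((natDegree_C_mul_le _ _).trans (natDegree_X_sub_C c).le))
  refine isMinimaxPoly_of_equioscillation hp hbound
    (t := fun j => if j = 0 then a else if j = 1 then c else b) ?_ ?_ (s := 1) (Or.inl rfl) ?_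
  · intro i j hij hj
    interval_cases j <;> interval_cases i <;> simp <;> linarith
  · intro j hj
    interval_cases j <;> simp [hab.le, hac.le, hcb.le]
  · intro j hj
    interval_cases j
    · simpa using hEa
    · simpa using hEc
    · simpa using hEb

end Convex

end Literature.Analysis.Approximation.AlternationBestApproximation
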